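import Mathlib
import Summits.Ventures.PercRepro2.OneEdge
import Summits.Ventures.PercRepro2.KPrimeReduction
import Summits.Ventures.PercRepro2.KPrimeVYDict
import Summits.Ventures.PercRepro2.KPrimeLeakPendant
import Summits.Ventures.PercRepro2.KPrimeLeakLinear
import Summits.Ventures.PercRepro2.KPrimeLeakGlueO1
import Summits.Ventures.PercRepro2.KPrimeLeakUGlue
import Summits.Ventures.PercRepro2.KPrimeLeakGlueHDBase

/-!
# The normaliser of the potential is monotone: `P(S)/P(N)` does not fall when `a₁`'s root
grows by `z`
(blind cell PercRepro2, mine-c g37; `conjectures/MINE-C.md` §46.10 (c), §46.12)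

`P⁰(S) · P¹¹(N) ≤ P¹¹(S) · P⁰(N)` (`glue_piece_sm`; `S = {a₂ ↮ {a₁, v}}`, `N = {a₁ ↮ {a₂, v}}`,
`P⁰ = p[e₂ ↦ 0]`, `P¹¹ = p[e₂ ↦ 1][e₁ ↦ 1]`) — the slack `sm_d0` of `uglue_lpdata.py`, the
factor by which the unfrozen potential `Num/(P(S)·P(N))` differs from the E-slope `Num/P(S)²`
(§46.10 (c): the slope itself is not monotone, the potential is census-monotone).  One world
(`sm_avoid_pa`): with `Q = {a₂ ↮ a₁}` and `Z = {a₂ ↮ z}`, `P(S) · P(N ∩ Z) ≤ P(S ∩ Z) · P(N)` —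
`S = {v ∉ C(a₂)} ∩ Q` is a decreasing cluster event of `a₂`, `N = E[P_{G∖L}(a₁ ↮ v) 1_Q]` an
increasing functional, `1[z ∉ L]` decreasing, and the cluster of `a₂` given `Q` is positively
associated (the two BHK steps of `hd_avoid_pa`, `ratio_combine`).  The leak: `P¹¹(S) =
P¹⁰(S ∩ Z)` (`prob_glued_S_eq`), `P¹¹(N) = P¹⁰(N ∩ {z ↮ {a₂, v}}) ≤ P¹⁰(N ∩ Z)`.
-/

namespace Summit.Ventures.PercRepro2

namespace KPrime

variable {V : Type*} {E : Type*} [Fintype E] [DecidableEq E] [Fintype V] [DecidableEq V]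
  {R : Type*} [Field R] [LinearOrder R] [IsStrictOrderedRing R]

section OneWorld

variable {ends : E → Sym2 V} {a₁ a₂ v z : V} {p : E → R}

omit [Fintype E] [DecidableEq E] [Fintype V] [Field R] [LinearOrder R]
  [IsStrictOrderedRing R] in
/-- `S = {v ∉ C(a₂)} ∩ {a₂ ↮ a₁}`. -/
lemma S_eq_clusterIn_inter :
    S ends a₁ a₂ v = clusterInEvent ends a₂ {L : Set V | v ∉ L} ∩ avoidAll ends a₂ {a₁} := by
  ext ω
  simp only [S, avoidAll, Set.mem_inter_iff, mem_clusterInEvent, Set.mem_setOf_eq, mem_cluster,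
    Finset.mem_insert, Finset.mem_singleton, forall_eq_or_imp, forall_eq]
  tauto

omit [Fintype E] [DecidableEq E] [Fintype V] [Field R] [LinearOrder R]
  [IsStrictOrderedRing R] in
/-- `S ∩ {a₂ ↮ z}` as a cluster event of `a₂`. -/
lemma S_inter_eq_clusterIn_inter :
    S ends a₁ a₂ v ∩ (connEvent ends a₂ z)ᶜ =
      clusterInEvent ends a₂ ({L : Set V | v ∉ L} ∩ {L : Set V | z ∉ L}) ∩
        avoidAll ends a₂ {a₁} := by
  ext ω
  simp only [S, avoidAll, Set.mem_inter_iff, Set.mem_compl_iff, mem_connEvent, mem_clusterInEvent,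
    Set.mem_setOf_eq, mem_cluster, Finset.mem_insert, Finset.mem_singleton, forall_eq_or_imp,
    forall_eq]
  tauto

/-- **PA of the avoided cluster of `a₂`, in the base world**: with `Q = {a₂ ↮ a₁}` and
`Z = {a₂ ↮ z}`, `P(S) · P(N ∩ Z) ≤ P(S ∩ Z) · P(N)`. -/
theorem sm_avoid_pa (hp : IsProbVec p) :
    prob p (S ends a₁ a₂ v) * prob p (N ends a₁ a₂ v ∩ (connEvent ends a₂ z)ᶜ) ≤
      prob p (S ends a₁ a₂ v ∩ (connEvent ends a₂ z)ᶜ) * prob p (N ends a₁ a₂ v) := by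
  classical
  have eN : N ends a₁ a₂ v =
      clusterInEvent ends a₂ Set.univ ∩ (connEvent ends a₁ v)ᶜ ∩ avoidAll ends a₂ {a₁} := by
    rw [N_eq_inter]
    ext ω
    simp only [Set.mem_inter_iff, mem_clusterInEvent, Set.mem_univ, true_and]
  have eNZ : N ends a₁ a₂ v ∩ (connEvent ends a₂ z)ᶜ =
      clusterInEvent ends a₂ {L : Set V | z ∉ L} ∩ (connEvent ends a₁ v)ᶜ ∩
        avoidAll ends a₂ {a₁} := by
    rw [N_eq_inter]
    ext ω
    simp only [Set.mem_inter_iff, Set.mem_compl_iff, mem_connEvent, mem_clusterInEvent,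
      Set.mem_setOf_eq, mem_cluster]
    tauto
  have hBcst : ∀ ω : Config E, ω ∈ avoidAll ends a₂ {a₁} →
      (ω ∈ (connEvent ends a₁ v)ᶜ ↔
        delConfig ends (cluster ends ω a₂) ω ∈ (connEvent ends a₁ v)ᶜ) :=
    fun ω hω => deletionStable_connEvent_compl hω
  have e3 := prob_clusterIn_inter_avoid_inter_eq_expect p ends a₂ (X := {a₁})
    Set.univ (connEvent ends a₁ v)ᶜ hBcst
  have e4 := prob_clusterIn_inter_avoid_inter_eq_expect p ends a₂ (X := {a₁})
    {L : Set V | z ∉ L} (connEvent ends a₁ v)ᶜ hBcst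
  rw [S_inter_eq_clusterIn_inter, S_eq_clusterIn_inter, eNZ, eN, e3, e4,
    prob_clusterInEvent_inter_eq_expect, prob_clusterInEvent_inter_eq_expect]
  have hgBc_mono : Monotone (delProb p ends (connEvent ends a₁ v)ᶜ) :=
    delProb_mono hp ((isUpperSet_connEvent ends a₁ v).compl)
  have hgBc0 : ∀ W, 0 ≤ delProb p ends (connEvent ends a₁ v)ᶜ W := fun W => delProb_nonneg hp _ W
  have hind_anti : ∀ (x : V),
      Antitone (({L : Set V | x ∉ L} : Set (Set V)).indicator (1 : Set V → R)) := by
    intro x W W' h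
    by_cases hW' : x ∉ W'
    · have hW : x ∉ W := fun hx => hW' (h hx)
      simp [Set.indicator_of_mem, hW, hW']
    · rw [Set.indicator_of_notMem hW']
      exact Set.indicator_apply_nonneg fun _ => zero_le_one
  have hind01 : ∀ (𝓤 : Set (Set V)) (W : Set V), 0 ≤ 𝓤.indicator (1 : Set V → R) W ∧
      𝓤.indicator (1 : Set V → R) W ≤ 1 := by
    intro 𝓤 W
    by_cases hW : W ∈ 𝓤
    · simp [Set.indicator_of_mem hW]
    · simp [Set.indicator_of_notMem hW]
  have hF_anti : Antitone (fun W : Set V => ({L : Set V | v ∉ L} : Set (Set V)).indicator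
      (1 : Set V → R) W) := hind_anti v
  have hF1 : ∀ W : Set V, ({L : Set V | v ∉ L} : Set (Set V)).indicator (1 : Set V → R) W ≤ 1 :=
    fun W => (hind01 _ W).2
  have hG_anti : Antitone (fun W : Set V => ({L : Set V | z ∉ L} : Set (Set V)).indicator
      (1 : Set V → R) W) := hind_anti z
  have hG1 : ∀ W : Set V, ({L : Set V | z ∉ L} : Set (Set V)).indicator (1 : Set V → R) W ≤ 1 :=
    fun W => (hind01 _ W).2
  -- (i): both decreasing
  have key1 := PSRecords.bhk_same_cluster_anti p hp ends a₂ a₁ hF_anti hG_anti hF1 hG1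
  -- (ii): increasing against decreasing
  have key2 := bhk_same_cluster p hp ends a₂ a₁
    (F₁ := delProb p ends (connEvent ends a₁ v)ᶜ)
    (F₂ := fun W => 1 - ({L : Set V | z ∉ L} : Set (Set V)).indicator (1 : Set V → R) W)
    hgBc_mono (fun _ _ h => sub_le_sub_left (hG_anti h) 1) hgBc0
    (fun W => sub_nonneg.2 (hG1 W))
  rw [← avoidAll_singleton_eq_compl a₂ a₁] at key1 key2
  have hFG : (fun ω => ({L : Set V | v ∉ L} : Set (Set V)).indicator (1 : Set V → R)
      (cluster ends ω a₂) * ({L : Set V | z ∉ L} : Set (Set V)).indicator (1 : Set V → R)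
      (cluster ends ω a₂) * (avoidAll ends a₂ {a₁}).indicator 1 ω) =
      fun ω => ({L : Set V | v ∉ L} ∩ {L : Set V | z ∉ L} : Set (Set V)).indicator (1 : Set V → R)
        (cluster ends ω a₂) * (avoidAll ends a₂ {a₁}).indicator 1 ω := by
    funext ω
    by_cases h1 : cluster ends ω a₂ ∈ ({L : Set V | v ∉ L} : Set (Set V)) <;>
      by_cases h2 : cluster ends ω a₂ ∈ ({L : Set V | z ∉ L} : Set (Set V)) <;>
      simp [h1, h2]
  rw [hFG] at key1
  have hN_univ : (fun ω => Set.univ.indicator (1 : Set V → R) (cluster ends ω a₂) *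
      delProb p ends (connEvent ends a₁ v)ᶜ (cluster ends ω a₂) *
      (avoidAll ends a₂ {a₁}).indicator 1 ω) =
      fun ω => delProb p ends (connEvent ends a₁ v)ᶜ (cluster ends ω a₂) *
        (avoidAll ends a₂ {a₁}).indicator 1 ω := by
    funext ω; simp
  have hNZ_fun : (fun ω => ({L : Set V | z ∉ L} : Set (Set V)).indicator (1 : Set V → R)
      (cluster ends ω a₂) * delProb p ends (connEvent ends a₁ v)ᶜ (cluster ends ω a₂) *
      (avoidAll ends a₂ {a₁}).indicator 1 ω) =
      fun ω => delProb p ends (connEvent ends a₁ v)ᶜ (cluster ends ω a₂) *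
        ({L : Set V | z ∉ L} : Set (Set V)).indicator (1 : Set V → R) (cluster ends ω a₂) *
        (avoidAll ends a₂ {a₁}).indicator 1 ω := by
    funext ω; ring
  rw [hN_univ, hNZ_fun]
  have hsub1 : (fun ω => (1 - ({L : Set V | z ∉ L} : Set (Set V)).indicator (1 : Set V → R)
      (cluster ends ω a₂)) * (avoidAll ends a₂ {a₁}).indicator 1 ω) =
      (avoidAll ends a₂ {a₁}).indicator 1 - fun ω =>
        ({L : Set V | z ∉ L} : Set (Set V)).indicator (1 : Set V → R) (cluster ends ω a₂) *
          (avoidAll ends a₂ {a₁}).indicator 1 ω := by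
    funext ω; simp only [Pi.sub_apply]; ring
  have hsub2 : (fun ω => delProb p ends (connEvent ends a₁ v)ᶜ (cluster ends ω a₂) *
      (1 - ({L : Set V | z ∉ L} : Set (Set V)).indicator (1 : Set V → R) (cluster ends ω a₂)) *
      (avoidAll ends a₂ {a₁}).indicator 1 ω) =
      (fun ω => delProb p ends (connEvent ends a₁ v)ᶜ (cluster ends ω a₂) *
        (avoidAll ends a₂ {a₁}).indicator 1 ω) -
      fun ω => delProb p ends (connEvent ends a₁ v)ᶜ (cluster ends ω a₂) *
        ({L : Set V | z ∉ L} : Set (Set V)).indicator (1 : Set V → R) (cluster ends ω a₂) *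
        (avoidAll ends a₂ {a₁}).indicator 1 ω := by
    funext ω; simp only [Pi.sub_apply]; ring
  rw [hsub1, hsub2, expect_sub, expect_sub, ← prob_eq_expect_indicator] at key2
  have hind0 : ∀ ω, 0 ≤ (avoidAll ends a₂ {a₁}).indicator (1 : Config E → R) ω :=
    fun ω => Set.indicator_apply_nonneg fun _ => zero_le_one
  have ha0 : 0 ≤ expect p fun ω => ({L : Set V | v ∉ L} : Set (Set V)).indicator (1 : Set V → R)
      (cluster ends ω a₂) * (avoidAll ends a₂ {a₁}).indicator 1 ω :=
    expect_nonneg hp fun ω => mul_nonneg (hind01 _ _).1 (hind0 ω)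
  have hc0 : 0 ≤ expect p fun ω => ({L : Set V | v ∉ L} ∩ {L : Set V | z ∉ L} : Set (Set V)).indicator
      (1 : Set V → R) (cluster ends ω a₂) * (avoidAll ends a₂ {a₁}).indicator 1 ω :=
    expect_nonneg hp fun ω => mul_nonneg (hind01 _ _).1 (hind0 ω)
  have hd0 : 0 ≤ expect p fun ω => delProb p ends (connEvent ends a₁ v)ᶜ (cluster ends ω a₂) *
      (avoidAll ends a₂ {a₁}).indicator 1 ω :=
    expect_nonneg hp fun ω => mul_nonneg (hgBc0 _) (hind0 ω)
  have hq0 : 0 ≤ prob p (avoidAll ends a₂ {a₁}) := prob_nonneg hp _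
  have haq : (expect p fun ω => ({L : Set V | v ∉ L} : Set (Set V)).indicator (1 : Set V → R)
      (cluster ends ω a₂) * (avoidAll ends a₂ {a₁}).indicator 1 ω) ≤
      prob p (avoidAll ends a₂ {a₁}) := by
    rw [prob_eq_expect_indicator]
    refine expect_mono hp fun ω => ?_
    by_cases hω : ω ∈ avoidAll ends a₂ {a₁}
    · simp only [Set.indicator_of_mem hω, Pi.one_apply, mul_one]
      exact hF1 _
    · simp [Set.indicator_of_notMem hω]
  have h2 : (expect p fun ω => delProb p ends (connEvent ends a₁ v)ᶜ (cluster ends ω a₂) *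
      ({L : Set V | z ∉ L} : Set (Set V)).indicator (1 : Set V → R) (cluster ends ω a₂) *
      (avoidAll ends a₂ {a₁}).indicator 1 ω) * prob p (avoidAll ends a₂ {a₁}) ≤
      (expect p fun ω => delProb p ends (connEvent ends a₁ v)ᶜ (cluster ends ω a₂) *
        (avoidAll ends a₂ {a₁}).indicator 1 ω) *
      expect p (fun ω => ({L : Set V | z ∉ L} : Set (Set V)).indicator (1 : Set V → R)
        (cluster ends ω a₂) * (avoidAll ends a₂ {a₁}).indicator 1 ω) := by
    nlinarith [key2]
  exact ratio_combine key1 h2 ha0 hc0 hd0 hq0 haq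

end OneWorld

section Leak

variable {ends : E → Sym2 V} {a₁ a₂ b v y z : V} {e₁ e₂ : E} {p : E → R}

/-- **The normaliser piece of the glue is a theorem**: with `b` attached to `a₁` by `e₁` and to
`z` by `e₂` (and to nothing else), `P⁰(S) · P¹¹(N) ≤ P¹¹(S) · P⁰(N)`: `P(S)/P(N)` does not fall
when `a₁`'s root grows by `z`. -/
theorem glue_piece_sm (hp : IsProbVec p) (hb : ∀ f, b ∈ ends f → f = e₁ ∨ f = e₂)
    (h₁ : ends e₁ = s(b, a₁)) (h₂ : ends e₂ = s(b, z)) (hne : e₁ ≠ e₂)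
    (hba₁ : b ≠ a₁) (hba₂ : b ≠ a₂) (hbv : b ≠ v) :
    prob (Function.update p e₂ 0) (S ends a₁ a₂ v) *
        prob (Function.update (Function.update p e₂ 1) e₁ 1) (N ends a₁ a₂ v) ≤
      prob (Function.update (Function.update p e₂ 1) e₁ 1) (S ends a₁ a₂ v) *
        prob (Function.update p e₂ 0) (N ends a₁ a₂ v) := by
  have hb' : ∀ f, b ∈ ends f → f = e₂ ∨ f = e₁ := fun f h => (hb f h).symm
  have hp'' : IsProbVec (Function.update (Function.update p e₂ 1) e₁ 0) :=
    (hp.update e₂ zero_le_one le_rfl).update e₁ le_rfl zero_le_one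
  have hNX : ∀ x ∈ ({a₂, v} : Finset V), x ≠ b := fun x hx => by
    simp only [Finset.mem_insert, Finset.mem_singleton] at hx
    rcases hx with rfl | rfl
    · exact Ne.symm hba₂
    · exact Ne.symm hbv
  have hSX : ∀ x ∈ ({a₁, v} : Finset V), x ≠ b := fun x hx => by
    simp only [Finset.mem_insert, Finset.mem_singleton] at hx
    rcases hx with rfl | rfl
    · exact Ne.symm hba₁
    · exact Ne.symm hbv
  have hN₁ : PendInv e₁ e₂ (N ends a₁ a₂ v) := pendInv_avoidAll hb h₁ hne (Ne.symm hba₁) hNX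
  have hN₂ : PendInv e₂ e₁ (N ends a₁ a₂ v) := pendInv_avoidAll hb' h₂ hne.symm (Ne.symm hba₁) hNX
  have hS₁ : PendInv e₁ e₂ (S ends a₁ a₂ v) := pendInv_avoidAll hb h₁ hne (Ne.symm hba₂) hSX
  have hS₂ : PendInv e₂ e₁ (S ends a₁ a₂ v) := pendInv_avoidAll hb' h₂ hne.symm (Ne.symm hba₂) hSX
  rw [← prob_pendantZ_eq_leakClosed hne hS₁ hS₂, ← prob_pendantZ_eq_leakClosed hne hN₁ hN₂,
    prob_glued_N_eq hb h₁ h₂ hne hba₂ hbv, prob_glued_S_eq hb h₁ h₂ hne hba₁ hba₂ hbv]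
  have hsub : N ends a₁ a₂ v ∩ avoidAll ends z {a₂, v} ⊆
      N ends a₁ a₂ v ∩ (connEvent ends a₂ z)ᶜ := by
    rintro ω ⟨hN, hZ⟩
    exact ⟨hN, fun hc => hZ a₂ (by simp) (conn_symm hc)⟩
  have eSZ : S ends a₁ a₂ v ∩ avoidAll ends a₂ {z} = S ends a₁ a₂ v ∩ (connEvent ends a₂ z)ᶜ := by
    rw [avoidAll_singleton_eq_compl]
  rw [eSZ]
  calc prob (Function.update (Function.update p e₂ 1) e₁ 0) (S ends a₁ a₂ v) *
        prob (Function.update (Function.update p e₂ 1) e₁ 0)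
          (N ends a₁ a₂ v ∩ avoidAll ends z {a₂, v})
      ≤ prob (Function.update (Function.update p e₂ 1) e₁ 0) (S ends a₁ a₂ v) *
        prob (Function.update (Function.update p e₂ 1) e₁ 0)
          (N ends a₁ a₂ v ∩ (connEvent ends a₂ z)ᶜ) :=
        mul_le_mul_of_nonneg_left (prob_mono hp'' hsub) (prob_nonneg hp'' _)
    _ ≤ prob (Function.update (Function.update p e₂ 1) e₁ 0)
          (S ends a₁ a₂ v ∩ (connEvent ends a₂ z)ᶜ) *
        prob (Function.update (Function.update p e₂ 1) e₁ 0) (N ends a₁ a₂ v) :=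
        sm_avoid_pa hp''

end Leak

end KPrime

end Summit.Ventures.PercRepro2
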